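import Mathlib
import HarnessLib
import Summits.Ventures.LatticeQCDFlow.Exactness.KernelCouplingMask

/-!
# Location couplings: the plaquette BEHIND an active link drives it — gauge equivariance, the coupling-layer bridge, exactness with the kernel's Jacobian, and the masks that freeze its staple

HONEST FRAMING: exact (Metropolis-corrected) sampling algorithms for lattice gauge theory;
figures of merit are autocorrelation/cost numbers at stated couplings and volumes; no
continuum-physics claim.

Venture `LatticeQCDFlow` (cell pub-lqcd), topic `Exactness`; FANOUT row 10 (`eng-equiv`, engine
`latflow.equiv`, module `equiv/masks.py` v0.3 "LOCATION COUPLINGS (2305.02402 §4.1.3):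
`LocationCoupling` = ONE site mask, and at every active site `x` ALL links `U_mu(x)`, `mu` in its
`pairs` `[(mu, nu(mu), sign)]` are active simultaneously, `U_mu(x)` being driven by the plaquette
BEHIND it in the `(mu, nu(mu))` plane (sign −1: `P_{mu nu}(x − nu)`, whose other three links sit at
`x − nu` and `x − nu + mu`).  Triangularity needs (i) every such active plaquette to contain
exactly one active link …"; presets `loc-checker`, `alternate`; also `DirectionCoupling` with
`sign = −1`).  NEW WORK of the cell over `KernelCouplingGaugeEquivariance.lean` (file 7: kernel
layers on conjugation-covariant loops are gauge equivariant), `KernelCouplingMask.lean` (file 11: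
the AHEAD-plaquette bridge and the direction masks) and `KernelCouplingJacobian.lean` (file 9);
nothing is cited as a fact; no number; no definition is introduced.  Printed counterpart, NAMED
ONLY: Abbott et al., arXiv:2305.02402 §4.1.3 (location couplings), App. 8.

## What is typed (`G` any group; `d`, `L` any; mask `p`, plane choice `ν e` per link)

The loop through the active link `e = (x, μ)` around the plaquette BEHIND it in the plane
`(μ, ν)`, started with the link: `W = V(x,μ) · V(x−ν̂+μ̂,ν)⁻¹ · V(x−ν̂,μ)⁻¹ · V(x−ν̂,ν)`.

* `behindLoop_eq_inv_conj_plaquetteHolonomy` — `W` is the inverse of the behind plaquette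
  `P_{μν}(x−ν̂)` transported to start at `x`;
* `behindStaple_gaugeTransform`, **`isGaugeEquivariant_behindPlaquetteKernelLayer`** — the
  behind staple transforms as a path from `x+μ̂` to `x`, so (file 7) the kernel layer
  `V e ↦ h(V,e)(W) W⁻¹ V e` is `IsGaugeEquivariant` for every gauge-invariant,
  conjugation-equivariant kernel field — any group, any mask, any plane choice;
* **`behindPlaquetteKernelLayer_eq_coupleFun`** — THE BRIDGE: if the three staple links
  `(x−ν̂+μ̂, ν)`, `(x−ν̂, μ)`, `(x−ν̂, ν)` are frozen at every active link and the kernel reads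
  frozen links only, the layer IS `Theory2.coupleFun p ψ` with
  `ψ ⟨e,_⟩ y u = H e y (u·B) (u·B)⁻¹ u`, `B` the behind staple read off the frozen links;
  **`hasJacobian_behindPlaquetteKernelLayer`** — hence exact for `⊗ Haar` with the kernels'
  Jacobians at the loops (`hasJacobian_kernelCouplingLayer`);
* **`locationMask_behindStaple_frozen`** — the engine's location masks meet the hypothesis:
  with an additive site phase `φ` and active set `p (x, μ') ↔ φ x = c ∧ μ' ∈ M` (all
  directions of `M` active at an active site), the three staple links of `(x, μ)` in the plane
  `ν` are frozen as soon as `φ(ν̂) ≠ 0` and `φ(μ̂) ≠ φ(ν̂)` — the conditions `validate()` checks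
  on the shift table found by `location_pairings`.

NOT here: condition (ii) of `validate()` (distinct active links own distinct active plaquettes —
immaterial for the coupling-layer structure, which is per link); any number.
-/

namespace Summit.Ventures.LatticeQCDFlow.Exactness

open Literature.MathematicalPhysics.QuantumFieldTheory

variable {d L : ℕ}

section AnyGroup

variable {G : Type*} [Group G]

/-! ## The loop behind the link -/

/-- Site arithmetic: `(x − ν̂ + μ̂) + ν̂ = x + μ̂` (a private copy of the tree's
`SU2StapleFieldCovariance.shift_sub_single_shift`, to keep the import light). -/
private theorem site_shift_sub_single_shift (x : Site d L) (μ ν : Fin d) :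
    ((x - Pi.single ν 1).shift μ).shift ν = x.shift μ := by
  simp only [Site.shift]
  abel

/-- **The behind loop is the inverse of the transported behind plaquette**:
`V(x,μ) V(x−ν̂+μ̂,ν)⁻¹ V(x−ν̂,μ)⁻¹ V(x−ν̂,ν) = (V(x−ν̂,ν)⁻¹ · P_{μν}(x−ν̂) · V(x−ν̂,ν))⁻¹`. -/
theorem behindLoop_eq_inv_conj_plaquetteHolonomy (V : GaugeConfig d L G) (x : Site d L) (μ ν : Fin d) :
    V (x, μ) * ((V ((x - Pi.single ν 1).shift μ, ν))⁻¹ * (V (x - Pi.single ν 1, μ))⁻¹ * V (x - Pi.single ν 1, ν)) =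
      ((V (x - Pi.single ν 1, ν))⁻¹ * plaquetteHolonomy V (x - Pi.single ν 1) μ ν * V (x - Pi.single ν 1, ν))⁻¹ := by
  unfold plaquetteHolonomy
  rw [shift_sub_single]
  group

/-- **The behind staple transforms as a path from `x + μ̂` back to `x`**:
`B(V^g) = g(x+μ̂) · B(V) · g(x)⁻¹` for `B = V(x−ν̂+μ̂,ν)⁻¹ V(x−ν̂,μ)⁻¹ V(x−ν̂,ν)`. -/
theorem behindStaple_gaugeTransform (ν : Edge d L → Fin d) (g : Site d L → G) (V : GaugeConfig d L G)
    (e : Edge d L) :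
    (gaugeTransform g V ((e.1 - Pi.single (ν e) 1).shift e.2, ν e))⁻¹ *
        (gaugeTransform g V (e.1 - Pi.single (ν e) 1, e.2))⁻¹ *
        gaugeTransform g V (e.1 - Pi.single (ν e) 1, ν e) =
      g (e.1.shift e.2) *
        ((V ((e.1 - Pi.single (ν e) 1).shift e.2, ν e))⁻¹ * (V (e.1 - Pi.single (ν e) 1, e.2))⁻¹ *
          V (e.1 - Pi.single (ν e) 1, ν e)) * (g e.1)⁻¹ := by
  simp only [gaugeTransform_apply]
  rw [site_shift_sub_single_shift, shift_sub_single]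
  group

/-- **The behind-plaquette kernel coupling layer is gauge equivariant** — any group, any mask,
any plane choice: `V e ↦ h(V,e)(W) · W⁻¹ · V e` with `W` the behind loop, for a kernel field
gauge invariant in the configuration and conjugation equivariant in the loop
(`isGaugeEquivariant_kernelLayer` with `conj_covariant_link_mul_staple`). -/
theorem isGaugeEquivariant_behindPlaquetteKernelLayer (p : Edge d L → Prop) [DecidablePred p]
    (ν : Edge d L → Fin d) (h : GaugeConfig d L G → Edge d L → G → G)
    (hinv : ∀ (g : Site d L → G) (V : GaugeConfig d L G) (e : Edge d L), p e →
      h (gaugeTransform g V) e = h V e)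
    (hconj : ∀ (V : GaugeConfig d L G) (e : Edge d L) (a b : G), p e →
      h V e (a * b * a⁻¹) = a * h V e b * a⁻¹) :
    IsGaugeEquivariant (fun (V : GaugeConfig d L G) (e : Edge d L) =>
      if p e then
        h V e (V e * ((V ((e.1 - Pi.single (ν e) 1).shift e.2, ν e))⁻¹ * (V (e.1 - Pi.single (ν e) 1, e.2))⁻¹ *
            V (e.1 - Pi.single (ν e) 1, ν e))) *
          (V e * ((V ((e.1 - Pi.single (ν e) 1).shift e.2, ν e))⁻¹ * (V (e.1 - Pi.single (ν e) 1, e.2))⁻¹ *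
            V (e.1 - Pi.single (ν e) 1, ν e)))⁻¹ * V e
      else V e) := by
  refine isGaugeEquivariant_kernelLayer p
    (fun V e => V e * ((V ((e.1 - Pi.single (ν e) 1).shift e.2, ν e))⁻¹ * (V (e.1 - Pi.single (ν e) 1, e.2))⁻¹ *
      V (e.1 - Pi.single (ν e) 1, ν e))) h ?_ hinv hconj
  intro g V e _
  have key := conj_covariant_link_mul_staple
    (fun V e => (V ((e.1 - Pi.single (ν e) 1).shift e.2, ν e))⁻¹ * (V (e.1 - Pi.single (ν e) 1, e.2))⁻¹ *
      V (e.1 - Pi.single (ν e) 1, ν e)) g V e (behindStaple_gaugeTransform ν g V e)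
  exact key

/-! ## The bridge: frozen behind staple + frozen context ⟹ coupling layer -/

/-- **The behind-plaquette kernel layer is a coupling layer.**  If at every active link
`e = (x, μ)` the staple links `(x−ν̂+μ̂, ν e)`, `(x−ν̂, μ)`, `(x−ν̂, ν e)` are frozen (`h4`–`h6`)
and the kernel is a function `H e` of the frozen links (`hH`), the layer equals
`Theory2.coupleFun p ψ`, `ψ ⟨e,_⟩ y u = H e y (u B) (u B)⁻¹ u` with the behind staple `B` read
off the frozen configuration `y`. -/
theorem behindPlaquetteKernelLayer_eq_coupleFun (p : Edge d L → Prop) [DecidablePred p]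
    (ν : Edge d L → Fin d) (h : GaugeConfig d L G → Edge d L → G → G)
    (H : (e : Edge d L) → ({f : Edge d L // ¬p f} → G) → G → G)
    (hH : ∀ (V : GaugeConfig d L G) (e : Edge d L), p e → h V e = H e (fun f => V f))
    (h4 : ∀ e, p e → ¬p ((e.1 - Pi.single (ν e) 1).shift e.2, ν e))
    (h5 : ∀ e, p e → ¬p (e.1 - Pi.single (ν e) 1, e.2))
    (h6 : ∀ e, p e → ¬p (e.1 - Pi.single (ν e) 1, ν e)) :
    (fun (V : GaugeConfig d L G) (e : Edge d L) =>
      if p e then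
        h V e (V e * ((V ((e.1 - Pi.single (ν e) 1).shift e.2, ν e))⁻¹ * (V (e.1 - Pi.single (ν e) 1, e.2))⁻¹ *
            V (e.1 - Pi.single (ν e) 1, ν e))) *
          (V e * ((V ((e.1 - Pi.single (ν e) 1).shift e.2, ν e))⁻¹ * (V (e.1 - Pi.single (ν e) 1, e.2))⁻¹ *
            V (e.1 - Pi.single (ν e) 1, ν e)))⁻¹ * V e
      else V e) =
    Theory2.coupleFun p (fun a y u =>
      H a.1 y (u * ((y ⟨_, h4 a.1 a.2⟩)⁻¹ * (y ⟨_, h5 a.1 a.2⟩)⁻¹ * y ⟨_, h6 a.1 a.2⟩)) *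
        (u * ((y ⟨_, h4 a.1 a.2⟩)⁻¹ * (y ⟨_, h5 a.1 a.2⟩)⁻¹ * y ⟨_, h6 a.1 a.2⟩))⁻¹ * u) := by
  funext V e
  by_cases he : p e
  · rw [if_pos he, Theory2.coupleFun_apply_of_pos _ _ he, hH V e he]
  · rw [if_neg he, Theory2.coupleFun_apply_of_neg _ _ he]

/-- **Hence the behind-plaquette kernel layer is exact with the kernels' Jacobians at the
loops** (compact group, Haar probability per link; `hasJacobian_kernelCouplingLayer` through the
bridge). -/
theorem hasJacobian_behindPlaquetteKernelLayer [TopologicalSpace G] [IsTopologicalGroup G]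
    [CompactSpace G] [MeasurableSpace G] [BorelSpace G] [NeZero L]
    (p : Edge d L → Prop) [DecidablePred p]
    (ν : Edge d L → Fin d) (h : GaugeConfig d L G → Edge d L → G → G)
    (H : (e : Edge d L) → ({f : Edge d L // ¬p f} → G) → G → G)
    (j : (e : Edge d L) → ({f : Edge d L // ¬p f} → G) → G → ℝ)
    (hH : ∀ (V : GaugeConfig d L G) (e : Edge d L), p e → h V e = H e (fun f => V f))
    (h4 : ∀ e, p e → ¬p ((e.1 - Pi.single (ν e) 1).shift e.2, ν e))
    (h5 : ∀ e, p e → ¬p (e.1 - Pi.single (ν e) 1, e.2))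
    (h6 : ∀ e, p e → ¬p (e.1 - Pi.single (ν e) 1, ν e))
    (hψ : ∀ a : {e // p e}, Measurable fun q : G × ({f : Edge d L // ¬p f} → G) =>
      H a.1 q.2 (q.1 * ((q.2 ⟨_, h4 a.1 a.2⟩)⁻¹ * (q.2 ⟨_, h5 a.1 a.2⟩)⁻¹ * q.2 ⟨_, h6 a.1 a.2⟩)) *
        (q.1 * ((q.2 ⟨_, h4 a.1 a.2⟩)⁻¹ * (q.2 ⟨_, h5 a.1 a.2⟩)⁻¹ * q.2 ⟨_, h6 a.1 a.2⟩))⁻¹ * q.1)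
    (hj : ∀ a : {e // p e}, Measurable fun q : G × ({f : Edge d L // ¬p f} → G) =>
      j a.1 q.2 (q.1 * ((q.2 ⟨_, h4 a.1 a.2⟩)⁻¹ * (q.2 ⟨_, h5 a.1 a.2⟩)⁻¹ * q.2 ⟨_, h6 a.1 a.2⟩)))
    (hJ : ∀ (a : {e // p e}) y, HasJacobian (haarProbability G) (H a.1 y) fun g => ENNReal.ofReal (j a.1 y g))
    (hj0 : ∀ (a : {e // p e}) y g, 0 ≤ j a.1 y g) :
    HasJacobian (MeasureTheory.Measure.pi fun _ : Edge d L => haarProbability G)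
      (fun (V : GaugeConfig d L G) (e : Edge d L) =>
        if p e then
          h V e (V e * ((V ((e.1 - Pi.single (ν e) 1).shift e.2, ν e))⁻¹ * (V (e.1 - Pi.single (ν e) 1, e.2))⁻¹ *
              V (e.1 - Pi.single (ν e) 1, ν e))) *
            (V e * ((V ((e.1 - Pi.single (ν e) 1).shift e.2, ν e))⁻¹ * (V (e.1 - Pi.single (ν e) 1, e.2))⁻¹ *
              V (e.1 - Pi.single (ν e) 1, ν e)))⁻¹ * V e
        else V e)
      fun V => ENNReal.ofReal (Theory2.coupleJac p (fun a y u =>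
        j a.1 y (u * ((y ⟨_, h4 a.1 a.2⟩)⁻¹ * (y ⟨_, h5 a.1 a.2⟩)⁻¹ * y ⟨_, h6 a.1 a.2⟩))) V) := by
  rw [behindPlaquetteKernelLayer_eq_coupleFun p ν h H hH h4 h5 h6]
  exact hasJacobian_kernelCouplingLayer p
    (fun a y => (y ⟨_, h4 a.1 a.2⟩)⁻¹ * (y ⟨_, h5 a.1 a.2⟩)⁻¹ * y ⟨_, h6 a.1 a.2⟩)
    (fun a y => H a.1 y) (fun a y => j a.1 y) hψ hj hJ hj0

end AnyGroup

/-! ## The engine's location masks freeze the behind staple -/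

section Masks

variable {A : Type*} [AddGroup A]

/-- **Location masks freeze the behind staple.**  Active set: all links in a direction set `M`
at the sites of phase `c`, `p (x, μ') ↔ φ x = c ∧ μ' ∈ M`, with an additive phase `φ`.  For an
active link `e = (x, μ)` and a plane `ν = ν e` with `φ(ν̂) ≠ 0` (the sites `x − ν̂` are inactive)
and `φ(μ̂) ≠ φ(ν̂)` (the site `x − ν̂ + μ̂` is inactive), the three links of the behind plaquette
other than `e` are frozen — whatever directions are in `M`. -/
theorem locationMask_behindStaple_frozen (φ : (Fin d → ZMod L) →+ A) (c : A) (M : Set (Fin d))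
    (ν : Edge d L → Fin d) (e : Edge d L) (he : φ e.1 = c ∧ e.2 ∈ M)
    (hν : φ (Pi.single (ν e) 1) ≠ 0) (hμν : φ (Pi.single e.2 1) ≠ φ (Pi.single (ν e) 1)) :
    ¬(φ ((e.1 - Pi.single (ν e) 1).shift e.2, ν e).1 = c ∧ ((e.1 - Pi.single (ν e) 1).shift e.2, ν e).2 ∈ M) ∧
    ¬(φ (e.1 - Pi.single (ν e) 1, e.2).1 = c ∧ (e.1 - Pi.single (ν e) 1, e.2).2 ∈ M) ∧
    ¬(φ (e.1 - Pi.single (ν e) 1, ν e).1 = c ∧ (e.1 - Pi.single (ν e) 1, ν e).2 ∈ M) := by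
  refine ⟨fun h => hμν ?_, fun h => hν ?_, fun h => hν ?_⟩
  · have h' : φ (e.1 - Pi.single (ν e) 1 + Pi.single e.2 1) = c := h.1
    rw [map_add, map_sub, he.1, sub_eq_add_neg, add_assoc] at h'
    exact (neg_add_eq_zero.mp (add_eq_left.mp h')).symm
  · have h' : φ (e.1 - Pi.single (ν e) 1) = c := h.1
    rw [map_sub, he.1] at h'
    exact sub_eq_self.mp h'
  · have h' : φ (e.1 - Pi.single (ν e) 1) = c := h.1
    rw [map_sub, he.1] at h'
    exact sub_eq_self.mp h'

/-- **Direction masks with `sign = −1` freeze the behind staple too**: for the direction mask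
`p (x, μ') ↔ μ' = μ ∧ φ x = c` and a plane `ν e ≠ μ` with `φ(ν̂) ≠ 0`, the links
`(x−ν̂+μ̂, ν e)`, `(x−ν̂, ν e)` are frozen by direction and `(x−ν̂, μ)` because the phase moves. -/
theorem directionMask_behindStaple_frozen (φ : (Fin d → ZMod L) →+ A) (c : A) (μ : Fin d)
    (ν : Edge d L → Fin d) (hνμ : ∀ e, ν e ≠ e.2) (e : Edge d L) (he : e.2 = μ ∧ φ e.1 = c)
    (hν : φ (Pi.single (ν e) 1) ≠ 0) :
    ¬(((e.1 - Pi.single (ν e) 1).shift e.2, ν e).2 = μ ∧ φ ((e.1 - Pi.single (ν e) 1).shift e.2, ν e).1 = c) ∧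
    ¬((e.1 - Pi.single (ν e) 1, e.2).2 = μ ∧ φ (e.1 - Pi.single (ν e) 1, e.2).1 = c) ∧
    ¬((e.1 - Pi.single (ν e) 1, ν e).2 = μ ∧ φ (e.1 - Pi.single (ν e) 1, ν e).1 = c) := by
  have hne : ν e ≠ μ := fun h => hνμ e (h.trans he.1.symm)
  refine ⟨fun h => hne h.1, fun h => hν ?_, fun h => hne h.1⟩
  have h' : φ (e.1 - Pi.single (ν e) 1) = c := h.2
  rw [map_sub, he.2] at h'
  exact sub_eq_self.mp h'

end Masks

end Summit.Ventures.LatticeQCDFlow.Exactness
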